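import Summits.HodgeConjecture.HodgeConjecture.Theses.AmpleAdicLefschetz
import Literature.AlgebraicGeometry.HodgeTheory.ComplexOrientationFamily
import Literature.AlgebraicGeometry.HodgeTheory.HodgeClassLiftRationalHodgeMaps
import Literature.AlgebraicGeometry.HodgeTheory.AlgebraicClassesHodgeTypeHolds
import Literature.AlgebraicGeometry.HodgeTheory.SupportedClassesRationalProofs
import Literature.AlgebraicGeometry.HodgeTheory.WeilClassesRationalPlane
import Literature.AlgebraicGeometry.HodgeTheory.LefschetzOneOneHolds
import Literature.AlgebraicGeometry.Motives.ComplexPointsManifold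
import HarnessLib

/-!
# Route AmpleAdicLefschetz — calibrations of the reflection stub of the crux line for `ThickDescent`
# (stmt-HodgeConjecture-2613): Gysin–pull-back reflection in codimension `≤ 1`, for `dim Y > dim X`,
# and from the Hodge conjecture

The crux `ThickDescent` is reduced (`Theorems/AmpleAdicLefschetzThickDescentOfReflection`,
`thickDescent_of_gysinPullbackReflectsAlgebraic`) to the X-side REFLECTION statement: for a morphism
`f : Y ⟶ X` of smooth projective complex varieties (`dim X = n`, `dim Y = m`, `2p + 2n = 2q + 2m`) an
ALGEBRAIC class of `X` of the form `f_* f^* x` is `f_* f^* a` with `a` ALGEBRAIC of codimension `p`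
(`f_*` the Gysin morphism of the complex orientations). That statement is open in general (for `Y` a
complete intersection of members of the polarising system it is the sub-middle algebraic-input
fragment of Grothendieck's standard conjecture `A(X, η)`). This file PROVES what is provable today on
the tree's carriers (sorry-free, standard axioms, no named fact and no definition introduced):

* `complexGysin_map_eq_zero_of_dim_lt` — for `dim Y > dim X`, `f_* f^* = 0` (`f_* f^* x ⌢ [X] =
  x ⌢ f(ℂ)_* [Y(ℂ)]` and `H_{2m}(X(ℂ)) = 0`, Hatcher Thm. 3.26(c); Poincaré duality); hence
  `gysinPullbackReflectsAlgebraic_of_dim_lt` (take `a = 0`).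
* `gysinPullbackReflectsAlgebraic_of_hodge` — for `dim Y ≤ dim X`, reflection at `(X, p)` follows from
  the Hodge conjecture for `X` in degree `2p` ALONE: `f_* f^*` is, up to a non-zero scalar, a rational
  Hodge-linear map of bidegree `(q - p, q - p)` (`isRationalHodgeMap_complexGysin_comp_map`, Voisin I
  §7.3.2), algebraic classes are rational-spanned and of type `(q,q)`, the functional trick
  (`sum_dual_smul_eq_zero_of_isRationalClass`, `sum_smul_mem_span_dual`, Hatcher §3.1 p. 198) puts
  `f_* f^* x` in the span of the rational algebraic classes IN THE IMAGE, and each of those lifts to a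
  rational `(p,p)`-class (`exists_isRationalClass_isOfHodgeType_eq_sum`, the semisimple lift of
  Voisin 2025 Cor. 2.12), algebraic by hypothesis.
* `gysinPullbackReflectsAlgebraic_zero` (`p = 0`: `Alg⁰ = ⊤`), `gysinPullbackReflectsAlgebraic_one`
  (`p = 1`, UNCONDITIONAL: Lefschetz `(1,1)`, the tree's `lefschetzOneOne_rational_holds`), and
  `gysinPullbackReflectsAlgebraic_of_hodgeConjecture` (the full stub from `HodgeConjecture`, so the
  stub is irrefutable short of a counterexample to the Hodge conjecture).

## References

* [VoisinHodgeI2002] C. Voisin, Hodge Theory and Complex Algebraic Geometry I (CUP 2002), §7.1.1,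
  §7.1.2, Lemma 7.26, §7.3.2, Thm. 11.30 (Lefschetz (1,1)).
* [Voisin2025] C. Voisin, Hodge and generalized Hodge conjectures, coniveau and algebraic cycles
  (2025), §2.1, Prop. 2.11, Cor. 2.12.
* [FultonYoungTableaux1997] W. Fulton, Young Tableaux (CUP 1997), App. B §B.1 (3)–(6).
* [HatcherAT2002] A. Hatcher, Algebraic Topology (CUP 2002), §3.1 p. 198, §3.3 Thm. 3.26(c), Thm. 3.30.
* [Grothendieck1968] A. Grothendieck, Standard conjectures on algebraic cycles (1968), §3.
-/

noncomputable section

-- mandated namespace `Summit.HodgeConjecture.HodgeConjecture.Theorems` (single-problem summit: Problem =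
-- Summit) trips `linter.dupNamespace`; off tree-wide in the lakefile, restated for stand-alone elaboration.
set_option linter.dupNamespace false

namespace Summit.HodgeConjecture.HodgeConjecture.Theorems

open CategoryTheory AlgebraicGeometry
open Literature.AlgebraicGeometry Literature.AlgebraicGeometry.Motives
open Literature.AlgebraicGeometry.HodgeTheory
open Literature.AlgebraicTopology.SingularHomology
open Summit.HodgeConjecture.HodgeConjecture.Theses.AmpleAdicLefschetz

/-! ### `dim Y > dim X`: the composite `f_* ∘ f^*` vanishes -/

/-- **For `dim Y > dim X` the composite `f_* f^*` vanishes identically** (`f : Y ⟶ X` a morphism of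
smooth projective complex varieties, degrees `a + 2n = b + 2m`): in degrees `a > 2m` the Gysin morphism
is `0` by definition; otherwise `f_* f^* x ⌢ [X(ℂ)] = f(ℂ)_*(f^* x ⌢ [Y(ℂ)]) = x ⌢ f(ℂ)_* [Y(ℂ)]`
(`capProduct_complexGysin`, `capProduct_map`) and `f(ℂ)_* [Y(ℂ)] ∈ H_{2m}(X(ℂ); ℂ) = 0` since
`2m > 2n = dim_ℝ X(ℂ)` (`ComplexPoints.isZero_singularHomology_of_lt`), so `f_* f^* x = 0` by Poincaré
duality (`hasPoincareDuality_complexOrientationFamily`). In print: `f_* f^* x = x ∪ f_* 1_Y` with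
`f_* 1_Y ∈ H^{2(n-m)}(X) = 0`. [cite: FultonYoungTableaux1997, Appendix B §B.1 (3)–(6)]
[cite: HatcherAT2002, §3.3 Thm. 3.26(c) and Thm. 3.30] -/
theorem complexGysin_map_eq_zero_of_dim_lt {n m a b : ℕ} {X Y : SchemeOver ℂ} (f : Y ⟶ X)
    (hX : IsSmoothProjective n X) (hY : IsSmoothProjective m Y) (hnm : n < m)
    (hab : a + 2 * n = b + 2 * m) (x : complexBetti X a) :
    complexGysin complexOrientationFamily hY hX f hab (complexBetti.map f a x) = 0 := by
  by_cases ha : a ≤ 2 * m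
  · -- `f_* f^* x ⌢ [X] = x ⌢ f_* [Y] = 0`, and `⌢ [X]` is injective
    have hq : a + (2 * m - a) = 2 * m := by omega
    have hb : b + (2 * m - a) = 2 * n := by omega
    have hcap := capProduct_complexGysin hasPoincareDuality_complexOrientationFamily hY hX f hab hq hb
      (complexBetti.map f a x)
    have hpush : singularHomology.map ℂ ℂ (Motives.AlgPoints.mapContinuous (L := ℂ) f) (2 * m - a)
        (capProduct hq (complexBetti.map f a x) (complexOrientationFamily hY).fundamentalClass) =
        capProduct hq x (singularHomology.map ℂ ℂ (Motives.AlgPoints.mapContinuous (L := ℂ) f) (2 * m)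
          (complexOrientationFamily hY).fundamentalClass) :=
      capProduct_map _ hq x _
    have hvan : singularHomology.map ℂ ℂ (Motives.AlgPoints.mapContinuous (L := ℂ) f) (2 * m)
        (complexOrientationFamily hY).fundamentalClass = 0 := by
      haveI := ModuleCat.subsingleton_of_isZero
        (Motives.ComplexPoints.isZero_singularHomology_of_lt hX ℂ ℂ (k := 2 * m) (by omega))
      exact Subsingleton.elim _ _
    rw [hpush, hvan, map_zero] at hcap
    -- Poincaré duality: `⌢ [X]` is injective in degree `b`
    have hinj := (hasPoincareDuality_complexOrientationFamily hX hb).1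
    apply hinj
    change capProduct hb _ (complexOrientationFamily hX).fundamentalClass =
      capProduct hb 0 (complexOrientationFamily hX).fundamentalClass
    rw [hcap, map_zero, LinearMap.zero_apply]
  · rw [complexGysin_of_lt hY hX f hab (not_le.1 ha), LinearMap.zero_apply]

/-- **Reflection for `dim Y > dim X`**: then `f_* f^* = 0` (`complexGysin_map_eq_zero_of_dim_lt`) and
`a = 0 ∈ Alg^p(X)` serves. [cite: FultonYoungTableaux1997, Appendix B §B.1 (5)–(6)] -/
theorem gysinPullbackReflectsAlgebraic_of_dim_lt {n m p q : ℕ} {X Y : SchemeOver ℂ} (f : Y ⟶ X)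
    (hX : IsSmoothProjective n X) (hY : IsSmoothProjective m Y) (hnm : n < m)
    (hpq : 2 * p + 2 * n = 2 * q + 2 * m) (x : complexBetti X (2 * p)) :
    ∃ a ∈ algebraicClasses X p,
      complexGysin complexOrientationFamily hY hX f hpq (complexBetti.map f (2 * p) a) =
        complexGysin complexOrientationFamily hY hX f hpq (complexBetti.map f (2 * p) x) := by
  refine ⟨0, Submodule.zero_mem _, ?_⟩
  rw [complexGysin_map_eq_zero_of_dim_lt f hX hY hnm hpq x, map_zero, map_zero]

/-! ### `dim Y ≤ dim X`: reflection from the Hodge conjecture for `X` in degree `2p` -/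

/-- **Reflection at `(X, p)` from the Hodge conjecture for `X` in degree `2p`** (`dim Y ≤ dim X`,
`2p + 2n = 2q + 2m`): if every rational `(p,p)`-class of `H²ᵖ(X(ℂ); ℂ)` is algebraic then an algebraic
class of the form `f_* f^* x` is `f_* f^* a` with `a ∈ Alg^p(X)`. Proof: `u • (f_* ∘ f^*)`, `u ≠ 0`,
carries rational classes to rational classes and `(a,b)`-classes to `(a + e, b + e)`-classes,
`p + e = q` (`isRationalHodgeMap_complexGysin_comp_map`); `f_* f^* x ∈ Alg^q(X)` lies in the span of the
rational algebraic classes (`supportedClasses_le_span_isRationalClass`) and `x` in the span of the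
rational classes (`span_isRationalClass_eq_top_of_isSmoothProjective_holds`), so by the functional trick
(`sum_dual_smul_eq_zero_of_isRationalClass`, `sum_smul_mem_span_dual`) `u • f_* f^* x` lies in the span
of rational algebraic classes which are themselves of the form `u • f_* f^* x'`; each of these is of type
`(q,q)` (`isOfHodgeType_of_mem_algebraicClasses_of_isSmoothProjective`) and lifts to a rational
`(p,p)`-class (`exists_isRationalClass_isOfHodgeType_eq_sum`, semisimplicity of polarised Hodge
structures), algebraic by hypothesis. [cite: Voisin2025, §2.1, Prop. 2.11 and Cor. 2.12]
[cite: VoisinHodgeI2002, §7.1.1, Lemma 7.26 and §7.3.2] [cite: HatcherAT2002, §3.1 p. 198] -/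
theorem gysinPullbackReflectsAlgebraic_of_hodge {n m p q : ℕ} {X Y : SchemeOver ℂ} (f : Y ⟶ X)
    (hX : IsSmoothProjective n X) (hY : IsSmoothProjective m Y) (hmn : m ≤ n)
    (hpq : 2 * p + 2 * n = 2 * q + 2 * m)
    (hHC : ∀ c : complexBetti X (2 * p), IsRationalClass c → IsOfHodgeType n X (2 * p) p p c →
      c ∈ algebraicClasses X p)
    (x : complexBetti X (2 * p))
    (hx : complexGysin complexOrientationFamily hY hX f hpq (complexBetti.map f (2 * p) x) ∈
      algebraicClasses X q) :
    ∃ a ∈ algebraicClasses X p,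
      complexGysin complexOrientationFamily hY hX f hpq (complexBetti.map f (2 * p) a) =
        complexGysin complexOrientationFamily hY hX f hpq (complexBetti.map f (2 * p) x) := by
  classical
  have he : p + (q - p) = q := by omega
  obtain ⟨u, hu, hrat, htyp⟩ := isRationalHodgeMap_complexGysin_comp_map complexOrientationFamily
    hasPoincareDuality_complexOrientationFamily hY hX hX f f hpq he
  -- the scaled composite `G = u • f_* f^*` as a linear map
  set T : complexBetti X (2 * p) →ₗ[ℂ] complexBetti X (2 * q) :=
    (complexGysin complexOrientationFamily hY hX f hpq) ∘ₗ (complexBetti.map f (2 * p)).hom with hTdef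
  have hT : ∀ z, T z = complexGysin complexOrientationFamily hY hX f hpq (complexBetti.map f (2 * p) z) :=
    fun z ↦ rfl
  set G : complexBetti X (2 * p) →ₗ[ℂ] complexBetti X (2 * q) := u • T with hGdef
  have hG : ∀ z, G z = u • T z := fun z ↦ rfl
  have hGrat : ∀ z, IsRationalClass z → IsRationalClass (G z) := fun z hz ↦ by
    rw [hG, hT]; exact hrat z hz
  -- (1) every rational algebraic class in the image of `G` is `G` of an algebraic class
  have hlift : ∀ r : complexBetti X (2 * q), IsRationalClass r → r ∈ algebraicClasses X q →
      r ∈ LinearMap.range G → r ∈ (algebraicClasses X p).map G := by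
    intro r hrQ hrA hrG
    have hrT : IsOfHodgeType n X (2 * q) q q r :=
      isOfHodgeType_of_mem_algebraicClasses_of_isSmoothProjective hX q hrA
    obtain ⟨a, ha, hra⟩ := exists_isRationalClass_isOfHodgeType_eq_sum hX (ι := Unit)
      (m := fun _ ↦ n) (d := fun _ ↦ p) (Y := fun _ ↦ X) (fun _ ↦ hX) q (fun _ ↦ q - p) (fun _ ↦ he)
      (fun _ ↦ G) (fun _ z hz ↦ hGrat z hz)
      (fun _ a' b' y hab hy ↦ by
        rw [hG, hT]
        exact (htyp hab hy).smul u)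
      hrQ hrT (by rw [iSup_const]; exact hrG)
    refine ⟨a (), hHC _ (ha ()).1 (ha ()).2, ?_⟩
    rw [hra, Fintype.sum_unique]
  -- (2) `u • f_* f^* x` lies in the span of the rational algebraic classes in the image of `G`
  set y : complexBetti X (2 * q) := T x with hydef
  have hyA : y ∈ algebraicClasses X q := hx
  -- `y` over rational algebraic classes, `x` over rational classes
  obtain ⟨k₁, g, b, hyb⟩ := Submodule.mem_span_set'.1
    (supportedClasses_le_span_isRationalClass hX (2 * q) q hyA)
  have hxs : x ∈ Submodule.span ℂ {c : complexBetti X (2 * p) | IsRationalClass c} := by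
    rw [span_isRationalClass_eq_top_of_isSmoothProjective_holds n X hX (2 * p)]
    exact Submodule.mem_top
  obtain ⟨k₂, h, v, hxv⟩ := Submodule.mem_span_set'.1 hxs
  -- the single rational relation `Σ hᵢ G vᵢ - Σ (u gⱼ) bⱼ = 0`
  let cf : Fin k₂ ⊕ Fin k₁ → ℂ := Sum.elim h (fun j ↦ -(u * g j))
  let vec : Fin k₂ ⊕ Fin k₁ → complexBetti X (2 * q) :=
    Sum.elim (fun i ↦ G (v i : complexBetti X (2 * p))) (fun j ↦ (b j : complexBetti X (2 * q)))
  have hvecQ : ∀ l, IsRationalClass (vec l) := by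
    rintro (i | j)
    · exact hGrat _ (v i).2
    · exact (b j).2.1
  have hrel : ∑ l, cf l • vec l = 0 := by
    rw [Fintype.sum_sum_type]
    simp only [cf, vec, Sum.elim_inl, Sum.elim_inr]
    have h1 : ∑ i, h i • G (v i : complexBetti X (2 * p)) = G x := by
      rw [← hxv, map_sum]
      simp only [map_smul]
    have h2 : ∑ j, (-(u * g j)) • (b j : complexBetti X (2 * q)) = -(u • y) := by
      rw [← hyb, Finset.smul_sum, ← Finset.sum_neg_distrib]
      refine Finset.sum_congr rfl fun j _ ↦ ?_
      rw [neg_smul, smul_smul]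
    rw [h1, h2, hG, hydef, add_neg_cancel]
  -- the span statement
  have hspan : u • y ∈ Submodule.span ℂ {r : complexBetti X (2 * q) |
      IsRationalClass r ∧ r ∈ algebraicClasses X q ∧ r ∈ LinearMap.range G} := by
    have huy : u • y = ∑ j, (u * g j) • (b j : complexBetti X (2 * q)) := by
      rw [← hyb, Finset.smul_sum]
      refine Finset.sum_congr rfl fun j _ ↦ ?_
      rw [smul_smul]
    rw [huy]
    refine Submodule.span_mono ?_ (sum_smul_mem_span_dual (fun j ↦ u * g j)
      (fun j ↦ (b j : complexBetti X (2 * q))))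
    rintro _ ⟨φ, rfl⟩
    refine ⟨IsRationalClass.sum_smul _ (fun j ↦ (b j).2.1) _, ?_, ?_⟩
    · exact Submodule.sum_mem _ fun j _ ↦ Submodule.smul_mem _ _ (b j).2.2
    · -- `Σ φ(u gⱼ) bⱼ = Σ φ(hᵢ) G vᵢ = G (Σ φ(hᵢ) vᵢ)` by the functional trick
      have hφ := sum_dual_smul_eq_zero_of_isRationalClass hvecQ hrel φ
      rw [Fintype.sum_sum_type] at hφ
      simp only [cf, vec, Sum.elim_inl, Sum.elim_inr] at hφ
      have hneg : ∀ j, ((φ (-(u * g j)) : ℚ) : ℂ) • (b j : complexBetti X (2 * q)) =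
          -(((φ (u * g j) : ℚ) : ℂ) • (b j : complexBetti X (2 * q))) := fun j ↦ by
        rw [map_neg, Rat.cast_neg, neg_smul]
      simp only [hneg, Finset.sum_neg_distrib] at hφ
      rw [add_neg_eq_zero] at hφ
      refine ⟨∑ i, ((φ (h i) : ℚ) : ℂ) • (v i : complexBetti X (2 * p)), ?_⟩
      rw [map_sum]
      simp only [map_smul]
      exact hφ
  -- (3) conclude: `u • y ∈ G (Alg^p)`, i.e. `y = f_* f^* a'` with `a'` algebraic
  have hle : Submodule.span ℂ {r : complexBetti X (2 * q) |
      IsRationalClass r ∧ r ∈ algebraicClasses X q ∧ r ∈ LinearMap.range G} ≤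
      (algebraicClasses X p).map G :=
    Submodule.span_le.2 fun r hr ↦ hlift r hr.1 hr.2.1 hr.2.2
  obtain ⟨a', ha', hGa'⟩ := Submodule.mem_map.1 (hle hspan)
  refine ⟨a', ha', ?_⟩
  have h' : u • T a' = u • y := by rw [← hG]; exact hGa'
  exact smul_right_injective _ hu h'

/-! ### Codimension `0` and `1`, and the full stub from the Hodge conjecture -/

/-- **Reflection in codimension `0`** holds trivially: `Alg⁰(X) = H⁰(X(ℂ); ℂ)`
(`algebraicClasses_zero`), so `a = x` serves. [cite: VoisinHodgeI2002, §11.3] -/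
theorem gysinPullbackReflectsAlgebraic_zero :
    ∀ ⦃n m q : ℕ⦄ ⦃X Y : SchemeOver ℂ⦄ (f : Y ⟶ X) (hX : IsSmoothProjective n X)
      (hY : IsSmoothProjective m Y) (hpq : 2 * 0 + 2 * n = 2 * q + 2 * m) (x : complexBetti X (2 * 0)),
      complexGysin complexOrientationFamily hY hX f hpq (complexBetti.map f (2 * 0) x) ∈
          algebraicClasses X q →
        ∃ a ∈ algebraicClasses X 0,
          complexGysin complexOrientationFamily hY hX f hpq (complexBetti.map f (2 * 0) a) =
            complexGysin complexOrientationFamily hY hX f hpq (complexBetti.map f (2 * 0) x) := by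
  intro n m q X Y f hX hY hpq x _
  exact ⟨x, by rw [algebraicClasses_zero]; exact Submodule.mem_top, rfl⟩

/-- **Reflection in codimension `1` holds unconditionally** (the `p = 1` calibration of the open stub
`stub_gysinPullbackReflectsAlgebraic` of the crux line for `ThickDescent`): for every morphism
`f : Y ⟶ X` of smooth projective complex varieties and `x ∈ H²(X(ℂ); ℂ)` with `f_* f^* x` algebraic,
there is `a ∈ Alg¹(X) = N¹ H²` with `f_* f^* a = f_* f^* x`. For `dim Y > dim X` by
`gysinPullbackReflectsAlgebraic_of_dim_lt`; for `dim Y ≤ dim X` by `gysinPullbackReflectsAlgebraic_of_hodge`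
with the Lefschetz theorem on `(1,1)`-classes (the tree's `lefschetzOneOne_rational_holds`).
[cite: VoisinHodgeI2002, Thm. 11.30 and §7.3.2] [cite: Voisin2025, Cor. 2.12] -/
theorem gysinPullbackReflectsAlgebraic_one :
    ∀ ⦃n m q : ℕ⦄ ⦃X Y : SchemeOver ℂ⦄ (f : Y ⟶ X) (hX : IsSmoothProjective n X)
      (hY : IsSmoothProjective m Y) (hpq : 2 * 1 + 2 * n = 2 * q + 2 * m) (x : complexBetti X (2 * 1)),
      complexGysin complexOrientationFamily hY hX f hpq (complexBetti.map f (2 * 1) x) ∈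
          algebraicClasses X q →
        ∃ a ∈ algebraicClasses X 1,
          complexGysin complexOrientationFamily hY hX f hpq (complexBetti.map f (2 * 1) a) =
            complexGysin complexOrientationFamily hY hX f hpq (complexBetti.map f (2 * 1) x) := by
  intro n m q X Y f hX hY hpq x hx
  rcases Nat.lt_or_ge n m with hnm | hmn
  · exact gysinPullbackReflectsAlgebraic_of_dim_lt f hX hY hnm hpq x
  · exact gysinPullbackReflectsAlgebraic_of_hodge f hX hY hmn hpq
      (fun c hc hh ↦ lefschetzOneOne_rational_holds hX c hc hh) x hx

/-- **The reflection stub follows from the Hodge conjecture** (so it is irrefutable short of a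
counterexample to the Hodge conjecture): for every morphism `f : Y ⟶ X` of smooth projective complex
varieties, `2p + 2n = 2q + 2m`, and `x ∈ H²ᵖ(X(ℂ); ℂ)` with `f_* f^* x` algebraic, there is
`a ∈ Alg^p(X)` with `f_* f^* a = f_* f^* x` — by `gysinPullbackReflectsAlgebraic_of_dim_lt` if
`dim Y > dim X`, else by `gysinPullbackReflectsAlgebraic_of_hodge` with `HodgeConjectureFor n X` in
degree `2p`. [cite: Voisin2025, §2.1 and Cor. 2.12] [cite: VoisinHodgeI2002, Lemma 7.26 and §7.3.2] -/
theorem gysinPullbackReflectsAlgebraic_of_hodgeConjecture :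
    _root_.HodgeConjecture →
    ∀ ⦃n m p q : ℕ⦄ ⦃X Y : SchemeOver ℂ⦄ (f : Y ⟶ X) (hX : IsSmoothProjective n X)
      (hY : IsSmoothProjective m Y) (hpq : 2 * p + 2 * n = 2 * q + 2 * m) (x : complexBetti X (2 * p)),
      complexGysin complexOrientationFamily hY hX f hpq (complexBetti.map f (2 * p) x) ∈
          algebraicClasses X q →
        ∃ a ∈ algebraicClasses X p,
          complexGysin complexOrientationFamily hY hX f hpq (complexBetti.map f (2 * p) a) =
            complexGysin complexOrientationFamily hY hX f hpq (complexBetti.map f (2 * p) x) := by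
  intro hHC n m p q X Y f hX hY hpq x hx
  rcases Nat.lt_or_ge n m with hnm | hmn
  · exact gysinPullbackReflectsAlgebraic_of_dim_lt f hX hY hnm hpq x
  · exact gysinPullbackReflectsAlgebraic_of_hodge f hX hY hmn hpq (fun c hc hh ↦ (hHC hX).2 p c hc hh) x hx

end Summit.HodgeConjecture.HodgeConjecture.Theorems

end
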